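import Literature.AlgebraicGeometry.Motives.StandardConjecturesDominatedVarieties
import Literature.AlgebraicGeometry.Motives.FrobeniusTrace
import Literature.RepresentationTheory.Semisimple.CharpolySubquotient
import Mathlib.Algebra.Polynomial.FieldDivision
import HarnessLib

/-!
# The Frobenius polynomials of a dominated variety divide those of the dominating variety
(Kleiman 1968 Prop. 1.2.4; Deligne 1974 (1.5)–(1.6))

Let `E` be a Galois Weil cohomology theory over a finite field `k` (the tree's
`GaloisWeilCohomology`, with geometric Frobenius `F` acting on `Hⁱ(X)` as `E.frobAction X i` and
`Pᵢ(X, T) = det(1 - T·F | Hⁱ(X))`, `E.frobCharPoly`). Pull-backs are Galois equivariant (axiom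
`pullback_ρ`), so `F` commutes with `f* : Hⁱ(U) → Hⁱ(V)` for every morphism `f : V ⟶ U` of
smooth projective varieties (`frobAction_comp_pullback`). When `f*` is injective — which holds
for every direct factor `U` of a product `U × Z` (`pullback_fst_injective`, from this lane's
`exists_algebraic_retraction_pullback_fst`) and for every `U` *dominated* by `V` in the sense of
`StandardConjecturesDominatedVarieties` (`f₊ ζ ≠ 0` for a multisection class `ζ ∈ Aʳ(V)_ℚ`;
Kleiman 1968 Prop. 1.2.4) — `Hⁱ(U)` is an `F`-stable subspace of `Hⁱ(V)`, hence

* `det(T - F | Hⁱ(U))` divides `det(T - F | Hⁱ(V))` and `Pᵢ(U, T)` divides `Pᵢ(V, T)` in `K[T]`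
  (`charpoly_frobAction_dvd_of_pullback_injective`, `frobCharPoly_dvd_of_pullback_injective`,
  `…_of_pushforward_ne_zero`, `frobCharPoly_dvd_frobCharPoly_tensor`; the linear algebra is
  Bourbaki's `χ(f) = χ(f|_p) χ(f mod p)`, the tree's `LinearMap.charpoly_eq_mul_of_exact`, here
  `LinearMap.charpoly_dvd_charpoly_of_comp_eq`);
* consequently **the Riemann hypothesis descends**: if `Pᵢ(V, T)` has integral models with all
  complex inverse roots of absolute value `q^{i/2}` (`E.WeilRiemannHypothesisFor V N`, Deligne 1974
  Thm. (1.6)) and the `Pᵢ(U, T)` have integral models (rationality, Katz–Messing 1974 Thm. 1), then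
  `E.WeilRiemannHypothesisFor U M` (`weilRiemannHypothesisFor_of_frobCharPoly_dvd`,
  `weilRiemannHypothesisFor_of_pushforward_ne_zero`) — the classical reduction of the Weil
  conjectures for varieties dominated by, e.g., products of curves.

Theorems only; no new definitions, no named facts.

## References

* [Kleiman1968AlgebraicCycles] S. Kleiman, *Algebraic cycles and the Weil conjectures*, in: Dix
  exposés sur la cohomologie des schémas (1968), §1.2 Prop. 1.2.4.
* [Deligne1974] P. Deligne, *La conjecture de Weil. I*, Publ. Math. IHÉS 43 (1974), (1.5), Thm. (1.6).
* [BourbakiAlgebreVIII2012] N. Bourbaki, *Algèbre*, Ch. VIII (2012), § 20 n° 6, p. 377.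
-/

universe u v

open CategoryTheory AlgebraicGeometry MonoidalCategory CartesianMonoidalCategory Polynomial

noncomputable section

namespace Literature.AlgebraicGeometry.Motives

/-! ## Linear algebra: the characteristic polynomial of an invariant subspace divides -/

/-- **`χ(f|_S)` divides `χ(f)`** for an `f`-stable subspace `S ↪ V` given by an injective linear map
`i : S → V` with `i ∘ f_S = f ∘ i` (Bourbaki, *Algèbre* VIII § 20 n° 6, p. 377:
`χ_E = χ_{E'} χ_{E''}` along `0 → E' → E → E'' → 0`; the tree's
`LinearMap.charpoly_eq_mul_of_exact` with `E'' = V / i(S)`). [cite: BourbakiAlgebreVIII2012, VIII § 20 n° 6 (p. 377)] -/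
theorem LinearMap.charpoly_dvd_charpoly_of_comp_eq {F : Type u} [Field F] {V : Type v}
    [AddCommGroup V] [Module F V] [FiniteDimensional F V] {S : Type*} [AddCommGroup S] [Module F S]
    [FiniteDimensional F S] (f : V →ₗ[F] V) (fS : S →ₗ[F] S) (i : S →ₗ[F] V)
    (hi : Function.Injective i) (hS : i ∘ₗ fS = f ∘ₗ i) : fS.charpoly ∣ f.charpoly := by
  set p : Submodule F V := LinearMap.range i
  have hp : p ≤ p.comap f := by
    rintro _ ⟨s, rfl⟩
    exact ⟨fS s, congr($hS s)⟩
  refine ⟨(p.mapQ p f hp).charpoly, ?_⟩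
  exact Literature.RepresentationTheory.Semisimple.LinearMap.charpoly_eq_mul_of_exact f i p.mkQ hi
    (Submodule.mkQ_surjective p) (Submodule.ker_mkQ p).symm fS (p.mapQ p f hp) hS
    (Submodule.mapQ_mkQ p p f).symm

namespace WeilCohomology

variable {k : Type u} [Field k] {K : Type v} [Field K] [CharZero K] (W : WeilCohomology k K)
variable {n m : ℕ} {X Z : SchemeOver k}

/-- **`pr_X^* : Hⁱ(X) → Hⁱ(X × Z)` is injective** for all smooth projective `X`, `Z` and every Weil
cohomology theory: it has the (algebraic) left inverse `pr_{X*} (· ∪ pr_Z^* a)`, `tr_Z a = 1`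
(`exists_algebraic_retraction_pullback_fst`; Kleiman 1968 Prop. 1.2.4 for the projection).
[cite: Kleiman1968AlgebraicCycles, §1.2 Prop. 1.2.4] -/
theorem pullback_fst_injective (hX : IsSmoothProjective n X) (hZ : IsSmoothProjective m Z) (i : ℕ) :
    Function.Injective (W.pullback (fst X Z) i) := by
  obtain ⟨B, -, -, hB⟩ := W.exists_algebraic_retraction_pullback_fst hX hZ
  exact Function.LeftInverse.injective (g := B i i) fun x ↦ congr($(hB i) x)

/-- **`pr_Z^* : Hⁱ(Z) → Hⁱ(X × Z)` is injective** (via the braiding `Z × X ≅ X × Z` and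
`pullback_fst_injective`). [cite: Kleiman1968AlgebraicCycles, §1.2 Prop. 1.2.4] -/
theorem pullback_snd_injective (hX : IsSmoothProjective n X) (hZ : IsSmoothProjective m Z) (i : ℕ) :
    Function.Injective (W.pullback (snd X Z) i) := by
  have h : snd X Z = (β_ X Z).hom ≫ fst Z X := by rw [braiding_hom_fst]
  have hβ : Function.Injective (W.pullback (β_ X Z).hom i) := by
    refine Function.LeftInverse.injective (g := W.pullback (β_ X Z).inv i) fun a ↦ ?_
    rw [← LinearMap.comp_apply, ← W.pullback_comp, Iso.inv_hom_id, W.pullback_id, LinearMap.id_apply]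
  rw [h, W.pullback_comp, LinearMap.coe_comp]
  exact hβ.comp (W.pullback_fst_injective hZ hX i)

end WeilCohomology

namespace GaloisWeilCohomology

variable {k : Type u} [Field k] [Finite k] {K : Type v} [Field K] [CharZero K]
  {χ : Field.absoluteGaloisGroup k →* Kˣ} (E : GaloisWeilCohomology k K χ)
variable {N M : ℕ} {V U : SchemeOver k}

/-! ## Frobenius commutes with pull-backs -/

/-- **The geometric Frobenius commutes with pull-backs**: `F ∘ f* = f* ∘ F` on `Hⁱ` for every
morphism `f : V ⟶ U` of smooth projective varieties (Galois equivariance of `f*`, axiom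
`pullback_ρ`; Deligne 1974 (1.5)). [cite: Deligne1974, (1.5)] -/
theorem frobAction_comp_pullback (hV : IsSmoothProjective N V) (hU : IsSmoothProjective M U)
    (f : V ⟶ U) (i : ℕ) :
    E.frobAction V i ∘ₗ E.pullback f i = E.pullback f i ∘ₗ E.frobAction U i :=
  E.pullback_ρ hV hU f i (geomFrob k)

/-! ## Divisibility of Frobenius polynomials under injective pull-back -/

/-- **`det(T - F | Hⁱ(U))` divides `det(T - F | Hⁱ(V))`** when `f* : Hⁱ(U) → Hⁱ(V)` is injective
(`Hⁱ(U)` is then an `F`-stable subspace of `Hⁱ(V)`; Bourbaki VIII § 20 n° 6). [cite: Deligne1974, (1.5)]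
[cite: BourbakiAlgebreVIII2012, VIII § 20 n° 6 (p. 377)] -/
theorem charpoly_frobAction_dvd_of_pullback_injective (hV : IsSmoothProjective N V)
    (hU : IsSmoothProjective M U) (f : V ⟶ U) {i : ℕ} (hinj : Function.Injective (E.pullback f i)) :
    (haveI := E.finite_obj hU i; (E.frobAction U i).charpoly) ∣
      (haveI := E.finite_obj hV i; (E.frobAction V i).charpoly) := by
  haveI := E.finite_obj hU i
  haveI := E.finite_obj hV i
  exact LinearMap.charpoly_dvd_charpoly_of_comp_eq (E.frobAction V i) (E.frobAction U i)
    (E.pullback f i) hinj (E.frobAction_comp_pullback hV hU f i).symm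

/-- **`Pᵢ(U, T)` divides `Pᵢ(V, T)`** (`Pᵢ = det(1 - T·F | Hⁱ)`, `E.frobCharPoly`) when
`f* : Hⁱ(U) → Hⁱ(V)` is injective (reversal is multiplicative). [cite: Deligne1974, (1.5.4)] -/
theorem frobCharPoly_dvd_of_pullback_injective (hV : IsSmoothProjective N V)
    (hU : IsSmoothProjective M U) (f : V ⟶ U) {i : ℕ} (hinj : Function.Injective (E.pullback f i)) :
    E.frobCharPoly U i ∣ E.frobCharPoly V i := by
  obtain ⟨Q, hQ⟩ := E.charpoly_frobAction_dvd_of_pullback_injective hV hU f hinj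
  rw [E.frobCharPoly_eq hU i, E.frobCharPoly_eq hV i]
  exact ⟨Q.reverse, by rw [hQ, Polynomial.reverse_mul_of_domain]⟩

/-- **`Pᵢ(U, T) ∣ Pᵢ(V, T)` for `U` dominated by `V`**: `f : V ⟶ U`, `dim V = dim U + r`, with
`f₊ ζ ≠ 0` for some `ζ ∈ Aʳ(V)_ℚ` (then `f*` is injective, Kleiman 1968 Prop. 1.2.4,
`pullback_injective_of_pushforward_ne_zero`). [cite: Kleiman1968AlgebraicCycles, §1.2 Prop. 1.2.4]
[cite: Deligne1974, (1.5.4)] -/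
theorem frobCharPoly_dvd_of_pushforward_ne_zero (hV : IsSmoothProjective N V)
    (hU : IsSmoothProjective M U) (f : V ⟶ U) {r : ℕ} {ζ : E.obj V (2 * r)}
    (hζ : ζ ∈ E.ratAlgebraicClasses V r) {he : 2 * r + 2 * M = 2 * N} {hd : 0 + 2 * M = 2 * M}
    (hne : E.pushforward (N := N) hU f he hd ζ ≠ 0) (i : ℕ) :
    E.frobCharPoly U i ∣ E.frobCharPoly V i :=
  E.frobCharPoly_dvd_of_pullback_injective hV hU f
    (E.pullback_injective_of_pushforward_ne_zero hV hU f hζ hne i)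

/-- Equidimensional case: **`Pᵢ(U, T) ∣ Pᵢ(V, T)` for `f : V ⟶ U` of non-zero degree**
(`f* ≠ 0` on `H²ᴺ(U)`; `pullback_injective_of_pullback_top_ne_zero`).
[cite: Kleiman1968AlgebraicCycles, §1.2 Prop. 1.2.4] [cite: Deligne1974, (1.5.4)] -/
theorem frobCharPoly_dvd_of_pullback_top_ne_zero (hV : IsSmoothProjective N V)
    (hU : IsSmoothProjective N U) (f : V ⟶ U) (hf : E.pullback f (2 * N) ≠ 0) (i : ℕ) :
    E.frobCharPoly U i ∣ E.frobCharPoly V i :=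
  E.frobCharPoly_dvd_of_pullback_injective hV hU f
    (E.pullback_injective_of_pullback_top_ne_zero hV hU f hf i)

/-- **`Pᵢ(X, T) ∣ Pᵢ(X × Z, T)`** for all smooth projective `X`, `Z` over a finite field
(`pr_X^*` is injective, `pullback_fst_injective`). [cite: Deligne1974, (1.5.4)]
[cite: Kleiman1968AlgebraicCycles, §1.2 Prop. 1.2.4] -/
theorem frobCharPoly_dvd_frobCharPoly_tensor {n m : ℕ} {X Z : SchemeOver k}
    (hX : IsSmoothProjective n X) (hZ : IsSmoothProjective m Z) (i : ℕ) :
    E.frobCharPoly X i ∣ E.frobCharPoly (X ⊗ Z) i :=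
  E.frobCharPoly_dvd_of_pullback_injective (IsSmoothProjective.tensor_holds hX hZ) hX (fst X Z)
    (E.pullback_fst_injective hX hZ i)

/-! ## The Riemann hypothesis descends along divisibility -/

/-- **The Riemann hypothesis descends along divisibility of Frobenius polynomials**: if
`Pᵢ(U, T) ∣ Pᵢ(V, T)` in `K[T]` for all `i ≤ 2 dim U`, `dim U ≤ dim V`, the `Pᵢ(U, T)` have
integral models (rationality) and `V` satisfies the Riemann hypothesis (integral models whose
complex roots have absolute value `q^{-i/2}`, Deligne 1974 Thm. (1.6)), then so does `U`:
divisibility of the images in `K[T]` of integer polynomials descends to `ℚ[T]`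
(`Polynomial.map_dvd_map'`), so every complex root of `Pᵢ(U)` is a root of `Pᵢ(V)`.
[cite: Deligne1974, Thm. (1.6)] -/
theorem weilRiemannHypothesisFor_of_frobCharPoly_dvd (hMN : M ≤ N)
    (hdvd : ∀ i : ℕ, i ≤ 2 * M → E.frobCharPoly U i ∣ E.frobCharPoly V i)
    (hint : ∀ i : Fin (2 * M + 1), ∃ P : ℤ[X], E.IsIntegralModel U i P)
    (hRH : E.WeilRiemannHypothesisFor V N) : E.WeilRiemannHypothesisFor U M := by
  choose Q hQ using hint
  obtain ⟨P, hP, hroots⟩ := hRH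
  refine ⟨Q, hQ, fun i z hz ↦ ?_⟩
  have hi : (i : ℕ) < 2 * N + 1 := by have := i.isLt; omega
  set j : Fin (2 * N + 1) := ⟨i, hi⟩
  -- divisibility over `K`, then over `ℚ`, then over `ℂ`
  have hK : (Q i).map (Int.castRingHom K) ∣ (P j).map (Int.castRingHom K) := by
    rw [hQ i, hP j]
    exact hdvd i (by have := i.isLt; omega)
  have hQK : ∀ R : ℤ[X], R.map (Int.castRingHom K) =
      (R.map (Int.castRingHom ℚ)).map (algebraMap ℚ K) := fun R ↦ by
    rw [Polynomial.map_map]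
    congr 1
    exact RingHom.ext_int _ _
  rw [hQK, hQK, Polynomial.map_dvd_map'] at hK
  have hC : (Q i).map (Int.castRingHom ℂ) ∣ (P j).map (Int.castRingHom ℂ) := by
    have h := Polynomial.map_dvd (algebraMap ℚ ℂ) hK
    rwa [Polynomial.map_map, Polynomial.map_map,
      show (algebraMap ℚ ℂ).comp (Int.castRingHom ℚ) = Int.castRingHom ℂ from RingHom.ext_int _ _]
      at h
  exact hroots j z (hz.dvd hC)

/-- **The Riemann hypothesis for `V` implies the Riemann hypothesis for every `U` dominated by
`V`**, given rationality of the `Pᵢ(U, T)`: `f : V ⟶ U`, `dim V = dim U + r`, `f₊ ζ ≠ 0` for some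
`ζ ∈ Aʳ(V)_ℚ` (Kleiman 1968 Prop. 1.2.4: `f*` injective; then `Pᵢ(U) ∣ Pᵢ(V)`). The classical
reduction of the Weil conjectures for varieties dominated by products of curves or abelian
varieties. [cite: Kleiman1968AlgebraicCycles, §1.2 Prop. 1.2.4] [cite: Deligne1974, Thm. (1.6)] -/
theorem weilRiemannHypothesisFor_of_pushforward_ne_zero (hV : IsSmoothProjective N V)
    (hU : IsSmoothProjective M U) (f : V ⟶ U) {r : ℕ} {ζ : E.obj V (2 * r)}
    (hζ : ζ ∈ E.ratAlgebraicClasses V r) {he : 2 * r + 2 * M = 2 * N} {hd : 0 + 2 * M = 2 * M}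
    (hne : E.pushforward (N := N) hU f he hd ζ ≠ 0)
    (hint : ∀ i : Fin (2 * M + 1), ∃ P : ℤ[X], E.IsIntegralModel U i P)
    (hRH : E.WeilRiemannHypothesisFor V N) : E.WeilRiemannHypothesisFor U M :=
  E.weilRiemannHypothesisFor_of_frobCharPoly_dvd (by omega)
    (fun i _ ↦ E.frobCharPoly_dvd_of_pushforward_ne_zero hV hU f hζ hne i) hint hRH

/-- **The Riemann hypothesis for `X × Z` implies the Riemann hypothesis for `X`**, given
rationality of the `Pᵢ(X, T)` (`Pᵢ(X) ∣ Pᵢ(X × Z)`). [cite: Deligne1974, Thm. (1.6)] -/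
theorem weilRiemannHypothesisFor_of_tensor {n m : ℕ} {X Z : SchemeOver k}
    (hX : IsSmoothProjective n X) (hZ : IsSmoothProjective m Z)
    (hint : ∀ i : Fin (2 * n + 1), ∃ P : ℤ[X], E.IsIntegralModel X i P)
    (hRH : E.WeilRiemannHypothesisFor (X ⊗ Z) (n + m)) : E.WeilRiemannHypothesisFor X n :=
  E.weilRiemannHypothesisFor_of_frobCharPoly_dvd (by omega)
    (fun i _ ↦ E.frobCharPoly_dvd_frobCharPoly_tensor hX hZ i) hint hRH

end GaloisWeilCohomology

end Literature.AlgebraicGeometry.Motives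

end
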